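import Summits.ResolutionOfSingularities.ResolutionOfSingularities.Theorems.FrobeniusLadderFInjectiveMacaulayficationClauseOfPderivNotMem
import Mathlib.RingTheory.MvPolynomial.WeightedHomogeneous
import Mathlib.Algebra.MvPolynomial.PDeriv
import Mathlib.Algebra.CharP.Lemmas
import Mathlib.Tactic.LinearCombination
import HarnessLib

/-!
# The weighted blow-up of the Brieskorn–Pham form `z² + x³ + y⁷`: the three cover charts
(crux `FInjectiveMacaulayfication`, line `Sketch`, §15 weighted cone engine — BP-TAME CALIBRATION)

Support file for crux stmt-ResolutionOfSingularities-15315 (`FrobeniusLadder.FInjectiveMacaulayfication`,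
line `Sketch`). [OURS · L1 W4.5a, CRUX-PLAN §6] — statements typed by plan-1 (`L/w45a/BP237-statements.lean`),
proved here; the calibration feeds the weighted cone engine #23 (`stub_weightedConeFiModel`) with the specimen
`f = X₂² + X₀³ + X₁⁷` (`X₀ = x`, `X₁ = y`, `X₂ = z`), weights `w = (14, 6, 21)`, `N = 84`, `c = (6, 14, 4)`,
`D = 42`, whose origin is F-injectivized by NO tower of point blow-ups (survey j023222) but — this package — by
ONE weighted blow-up, in every characteristic `p ∉ {2, 3, 7}`.

For each chart `v` the root-cover substitution `θ_v : X_v ↦ X_v^{w_v}, X_j ↦ X_j X_v^{w_j}` gives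
`θ_v f = X_v^42 · g_v` with

* `v = 0` (`x`-chart): `g₀ = X₂² + 1 + X₁⁷`, residual weights `(1, -6, -21)` in `ZMod 14`;
* `v = 1` (`y`-chart): `g₁ = X₂² + X₀³ + 1`, residual weights `(-14, 1, -21)` in `ZMod 6`;
* `v = 2` (`z`-chart): `g₂ = 1 + X₀³ + X₁⁷`, residual weights `(-14, -6, 1)` in `ZMod 21`;

and `bp237ChartX/Y/Z` prove, verbatim in plan-1's typing: the chart identity (`ring`), weighted homogeneity of
`g_v` of weight `0` (monomialwise, the weights `-42` vanish in `ZMod w_v`, `decide`), `X_v ∤ g_v` (evaluate at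
the origin), and the Cohen–Macaulay + Frobenius-closed clause at EVERY maximal ideal of `k[X]/(g_v)`: each chart
is SMOOTH when `2, 3, 7` are units — if the relevant partials (`2X₂`, `3X₀²`, `7X₁⁶`) all lay in `P = Q ∩ k[X]`,
then two variables lie in `P` and `1 = g_v - (…) ∈ P`; so the Jacobian discharger
`ClauseOfPderivNotMem.stub_clauseOfPderivNotMem` applies in some direction. Template: `F4ChartY` (p458929).

References: [Matsumura1987] H. Matsumura, *Commutative Ring Theory*, Thm. 30.4 (through the imported Jacobian
discharger). The computation itself is folklore.
-/

-- single-problem summit: the doubled namespace component is forced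
set_option linter.dupNamespace false

noncomputable section

namespace Summit.ResolutionOfSingularities.ResolutionOfSingularities.Theorems.FInjectiveMacaulayfication.BP237Charts

open MvPolynomial
open Summit.ResolutionOfSingularities.ResolutionOfSingularities.Theorems.FInjectiveMacaulayfication

/-! ## Units `2, 3, 7` in characteristic `p ∉ {2,3,7}` -/

/-- In characteristic `p`, a prime `q ≠ p` is a unit of `k[X₀,X₁,X₂]`. [folklore] -/
theorem isUnit_natCast_of_ne (p : ℕ) [Fact p.Prime] (k : Type) [Field k] [CharP k p] (q : ℕ)
    (hq : q.Prime) (hpq : p ≠ q) : IsUnit ((q : ℕ) : MvPolynomial (Fin 3) k) := by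
  have hk : ((q : ℕ) : k) ≠ 0 := by
    rw [Ne, CharP.cast_eq_zero_iff k p q]
    exact fun h => hpq ((Nat.prime_dvd_prime_iff_eq (Fact.out) hq).mp h)
  have h := (isUnit_iff_ne_zero.mpr hk).map (MvPolynomial.C : k →+* MvPolynomial (Fin 3) k)
  rwa [map_natCast] at h

/-! ## Partial derivatives of the chart polynomials (over any commutative ring) -/

/-- `∂₂ (X₂² + 1 + X₁⁷) = 2X₂`. [folklore] -/
theorem pderiv_two_g0 {A : Type*} [CommRing A] :
    pderiv 2 (X 2 ^ 2 + 1 + X 1 ^ 7 : MvPolynomial (Fin 3) A) = 2 * X 2 := by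
  simp only [map_add, pderiv_one, pderiv_pow, pderiv_X_self,
    pderiv_X_of_ne (show (1 : Fin 3) ≠ 2 by decide),
    Nat.reduceSub, pow_one, mul_one, mul_zero, add_zero, Nat.cast_ofNat]

/-- `∂₁ (X₂² + 1 + X₁⁷) = 7X₁⁶`. [folklore] -/
theorem pderiv_one_g0 {A : Type*} [CommRing A] :
    pderiv 1 (X 2 ^ 2 + 1 + X 1 ^ 7 : MvPolynomial (Fin 3) A) = 7 * X 1 ^ 6 := by
  simp only [map_add, pderiv_one, pderiv_pow, pderiv_X_self,
    pderiv_X_of_ne (show (2 : Fin 3) ≠ 1 by decide),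
    Nat.reduceSub, pow_one, mul_one, mul_zero, add_zero, zero_add, Nat.cast_ofNat]

/-- `∂₂ (X₂² + X₀³ + 1) = 2X₂`. [folklore] -/
theorem pderiv_two_g1 {A : Type*} [CommRing A] :
    pderiv 2 (X 2 ^ 2 + X 0 ^ 3 + 1 : MvPolynomial (Fin 3) A) = 2 * X 2 := by
  simp only [map_add, pderiv_one, pderiv_pow, pderiv_X_self,
    pderiv_X_of_ne (show (0 : Fin 3) ≠ 2 by decide),
    Nat.reduceSub, pow_one, mul_one, mul_zero, add_zero, Nat.cast_ofNat]

/-- `∂₀ (X₂² + X₀³ + 1) = 3X₀²`. [folklore] -/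
theorem pderiv_zero_g1 {A : Type*} [CommRing A] :
    pderiv 0 (X 2 ^ 2 + X 0 ^ 3 + 1 : MvPolynomial (Fin 3) A) = 3 * X 0 ^ 2 := by
  simp only [map_add, pderiv_one, pderiv_pow, pderiv_X_self,
    pderiv_X_of_ne (show (2 : Fin 3) ≠ 0 by decide),
    Nat.reduceSub, pow_one, mul_one, mul_zero, add_zero, zero_add, Nat.cast_ofNat]

/-- `∂₀ (1 + X₀³ + X₁⁷) = 3X₀²`. [folklore] -/
theorem pderiv_zero_g2 {A : Type*} [CommRing A] :
    pderiv 0 (1 + X 0 ^ 3 + X 1 ^ 7 : MvPolynomial (Fin 3) A) = 3 * X 0 ^ 2 := by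
  simp only [map_add, pderiv_one, pderiv_pow, pderiv_X_self,
    pderiv_X_of_ne (show (1 : Fin 3) ≠ 0 by decide),
    Nat.reduceSub, mul_one, mul_zero, add_zero, zero_add, Nat.cast_ofNat]

/-- `∂₁ (1 + X₀³ + X₁⁷) = 7X₁⁶`. [folklore] -/
theorem pderiv_one_g2 {A : Type*} [CommRing A] :
    pderiv 1 (1 + X 0 ^ 3 + X 1 ^ 7 : MvPolynomial (Fin 3) A) = 7 * X 1 ^ 6 := by
  simp only [map_add, pderiv_one, pderiv_pow, pderiv_X_self,
    pderiv_X_of_ne (show (0 : Fin 3) ≠ 1 by decide),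
    Nat.reduceSub, mul_one, mul_zero, add_zero, zero_add, Nat.cast_ofNat]

/-! ## Weighted homogeneity of the chart polynomials -/

/-- `g₀ = X₂² + 1 + X₁⁷` has weight `0` for `W = (1, -6, -21)` in `ZMod 14`. [folklore] -/
theorem isWeightedHomogeneous_g0 (k : Type) [Field k] :
    MvPolynomial.IsWeightedHomogeneous (![1, -6, -21] : Fin 3 → ZMod 14)
      (X 2 ^ 2 + 1 + X 1 ^ 7 : MvPolynomial (Fin 3) k) 0 := by
  have hX : ∀ j : Fin 3, IsWeightedHomogeneous (![1, -6, -21] : Fin 3 → ZMod 14)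
      (X j : MvPolynomial (Fin 3) k) ((![1, -6, -21] : Fin 3 → ZMod 14) j) :=
    fun j => isWeightedHomogeneous_X k _ j
  have h2 : IsWeightedHomogeneous (![1, -6, -21] : Fin 3 → ZMod 14) (X 2 ^ 2 : MvPolynomial (Fin 3) k) 0 := by
    have h := (hX 2).pow 2
    rwa [show 2 • (![1, -6, -21] : Fin 3 → ZMod 14) 2 = 0 from by decide] at h
  have h1 : IsWeightedHomogeneous (![1, -6, -21] : Fin 3 → ZMod 14) (X 1 ^ 7 : MvPolynomial (Fin 3) k) 0 := by
    have h := (hX 1).pow 7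
    rwa [show 7 • (![1, -6, -21] : Fin 3 → ZMod 14) 1 = 0 from by decide] at h
  exact (h2.add (isWeightedHomogeneous_one k _)).add h1

/-- `g₁ = X₂² + X₀³ + 1` has weight `0` for `W = (-14, 1, -21)` in `ZMod 6`. [folklore] -/
theorem isWeightedHomogeneous_g1 (k : Type) [Field k] :
    MvPolynomial.IsWeightedHomogeneous (![-14, 1, -21] : Fin 3 → ZMod 6)
      (X 2 ^ 2 + X 0 ^ 3 + 1 : MvPolynomial (Fin 3) k) 0 := by
  have hX : ∀ j : Fin 3, IsWeightedHomogeneous (![-14, 1, -21] : Fin 3 → ZMod 6)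
      (X j : MvPolynomial (Fin 3) k) ((![-14, 1, -21] : Fin 3 → ZMod 6) j) :=
    fun j => isWeightedHomogeneous_X k _ j
  have h2 : IsWeightedHomogeneous (![-14, 1, -21] : Fin 3 → ZMod 6) (X 2 ^ 2 : MvPolynomial (Fin 3) k) 0 := by
    have h := (hX 2).pow 2
    rwa [show 2 • (![-14, 1, -21] : Fin 3 → ZMod 6) 2 = 0 from by decide] at h
  have h0 : IsWeightedHomogeneous (![-14, 1, -21] : Fin 3 → ZMod 6) (X 0 ^ 3 : MvPolynomial (Fin 3) k) 0 := by
    have h := (hX 0).pow 3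
    rwa [show 3 • (![-14, 1, -21] : Fin 3 → ZMod 6) 0 = 0 from by decide] at h
  exact (h2.add h0).add (isWeightedHomogeneous_one k _)

/-- `g₂ = 1 + X₀³ + X₁⁷` has weight `0` for `W = (-14, -6, 1)` in `ZMod 21`. [folklore] -/
theorem isWeightedHomogeneous_g2 (k : Type) [Field k] :
    MvPolynomial.IsWeightedHomogeneous (![-14, -6, 1] : Fin 3 → ZMod 21)
      (1 + X 0 ^ 3 + X 1 ^ 7 : MvPolynomial (Fin 3) k) 0 := by
  have hX : ∀ j : Fin 3, IsWeightedHomogeneous (![-14, -6, 1] : Fin 3 → ZMod 21)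
      (X j : MvPolynomial (Fin 3) k) ((![-14, -6, 1] : Fin 3 → ZMod 21) j) :=
    fun j => isWeightedHomogeneous_X k _ j
  have h0 : IsWeightedHomogeneous (![-14, -6, 1] : Fin 3 → ZMod 21) (X 0 ^ 3 : MvPolynomial (Fin 3) k) 0 := by
    have h := (hX 0).pow 3
    rwa [show 3 • (![-14, -6, 1] : Fin 3 → ZMod 21) 0 = 0 from by decide] at h
  have h1 : IsWeightedHomogeneous (![-14, -6, 1] : Fin 3 → ZMod 21) (X 1 ^ 7 : MvPolynomial (Fin 3) k) 0 := by
    have h := (hX 1).pow 7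
    rwa [show 7 • (![-14, -6, 1] : Fin 3 → ZMod 21) 1 = 0 from by decide] at h
  exact ((isWeightedHomogeneous_one k _).add h0).add h1

/-! ## The clause on a smooth chart: two partials `u·Xᵢ^a`, `u'·Xⱼ^b` with unit coefficients and `g ≡ 1 mod (Xᵢ, Xⱼ)` -/

/-- **Smooth-chart discharger.** `g ∈ k[X₀,X₁,X₂]`, `k` of characteristic `p`; suppose two partials of `g` are
`∂ᵢ g = u·Xᵢ'^a` and `∂ⱼ g = u'·Xⱼ'^b` with `u, u'` units, and `g - 1 ∈ (Xᵢ', Xⱼ')` (witnessed by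
`g = 1 + Xᵢ'·r + Xⱼ'·r'`). Then `k[X]/(g)` satisfies the Cohen–Macaulay + Frobenius-closed clause at every maximal
ideal: were both partials in `P = Q ∩ k[X] ∋ g`, then `Xᵢ', Xⱼ' ∈ P` and `1 ∈ P`; otherwise the Jacobian
discharger applies. [folklore] -/
theorem clause_of_two_partials (p : ℕ) [Fact p.Prime] (k : Type) [Field k] [CharP k p]
    (g : MvPolynomial (Fin 3) k) (i j i' j' : Fin 3) (a b : ℕ) (u u' r r' : MvPolynomial (Fin 3) k)
    (hu : IsUnit u) (hu' : IsUnit u')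
    (hdi : pderiv i g = u * X i' ^ a) (hdj : pderiv j g = u' * X j' ^ b)
    (hg1 : g = 1 + X i' * r + X j' * r') :
    ∀ (Q : Ideal (MvPolynomial (Fin 3) k ⧸ Ideal.span {g})) [Q.IsMaximal], ∀ d : ℕ,
      ringKrullDim (Localization.AtPrime Q) = d → ∀ s : Fin d → Localization.AtPrime Q,
      (Ideal.span (Set.range s)).radical.IsMaximal →
        RingTheory.Sequence.IsWeaklyRegular (Localization.AtPrime Q) (List.ofFn s) ∧
        ∀ y : Localization.AtPrime Q, (∃ e : ℕ, y ^ p ^ e ∈ Ideal.span ((fun z : Localization.AtPrime Q =>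
          z ^ p ^ e) '' (Ideal.span (Set.range s) : Set (Localization.AtPrime Q)))) → y ∈ Ideal.span (Set.range s) := by
  intro Q _ d hd s hs
  haveI hP₀max : (Q.comap (Ideal.Quotient.mk (Ideal.span {g}))).IsMaximal :=
    Ideal.comap_isMaximal_of_surjective _ Ideal.Quotient.mk_surjective
  have hP₀ := hP₀max.isPrime
  by_cases hmi : pderiv i g ∈ Q.comap (Ideal.Quotient.mk (Ideal.span {g})); swap
  · exact ClauseOfPderivNotMem.stub_clauseOfPderivNotMem p k 3 g Q i hmi d hd s hs
  by_cases hmj : pderiv j g ∈ Q.comap (Ideal.Quotient.mk (Ideal.span {g})); swap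
  · exact ClauseOfPderivNotMem.stub_clauseOfPderivNotMem p k 3 g Q j hmj d hd s hs
  exfalso
  have hgP : g ∈ Q.comap (Ideal.Quotient.mk (Ideal.span {g})) := by
    rw [Ideal.mem_comap, Ideal.Quotient.eq_zero_iff_mem.mpr (Ideal.mem_span_singleton_self g)]
    exact Q.zero_mem
  have hXi : (X i' : MvPolynomial (Fin 3) k) ∈ Q.comap (Ideal.Quotient.mk (Ideal.span {g})) := by
    rw [hdi] at hmi
    exact hP₀.mem_of_pow_mem a ((Ideal.unit_mul_mem_iff_mem _ hu).mp hmi)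
  have hXj : (X j' : MvPolynomial (Fin 3) k) ∈ Q.comap (Ideal.Quotient.mk (Ideal.span {g})) := by
    rw [hdj] at hmj
    exact hP₀.mem_of_pow_mem b ((Ideal.unit_mul_mem_iff_mem _ hu').mp hmj)
  have h1 : (1 : MvPolynomial (Fin 3) k) ∈ Q.comap (Ideal.Quotient.mk (Ideal.span {g})) := by
    have e : (1 : MvPolynomial (Fin 3) k) = g - (X i' * r + X j' * r') := by rw [hg1]; ring
    rw [e]
    exact Ideal.sub_mem _ hgP (Ideal.add_mem _ (Ideal.mul_mem_right _ _ hXi) (Ideal.mul_mem_right _ _ hXj))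
  exact hP₀max.ne_top ((Ideal.eq_top_iff_one _).mpr h1)

/-- **`X_v ∤ g`** when `g` evaluates to `1` at the origin. [folklore] -/
theorem not_X_dvd_of_eval_zero (k : Type) [Field k] (v : Fin 3) (g : MvPolynomial (Fin 3) k)
    (hg : MvPolynomial.eval (fun _ : Fin 3 => (0 : k)) g = 1) : ¬ (X v : MvPolynomial (Fin 3) k) ∣ g := by
  rintro ⟨h, hh⟩
  have h1 := congrArg (MvPolynomial.eval fun _ : Fin 3 => (0 : k)) hh
  rw [hg, map_mul, MvPolynomial.eval_X, zero_mul] at h1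
  exact one_ne_zero h1

/-! ## The three charts (plan-1's typed statements, verbatim) -/

/-- **The `x`-chart (`v = 0`) of the weighted blow-up of `z² + x³ + y⁷`** (`w = (14,6,21)`, `N = 84`):
`θ₀ f = X₀^42 · g₀`, `g₀ = X₂² + 1 + X₁⁷` weighted homogeneous of weight `0` for `(1,-6,-21)` in `ZMod 14`,
`X₀ ∤ g₀`, and — for `p ∉ {2,3,7}` — the clause at every maximal ideal of `k[X]/(g₀)` (smooth chart:
`∂₂ g₀ = 2X₂`, `∂₁ g₀ = 7X₁⁶`, `g₀ ≡ 1 mod (X₂, X₁)`). [folklore] -/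
theorem bp237ChartX : ∀ (p : ℕ) [Fact p.Prime] (k : Type) [Field k] [CharP k p], p ≠ 2 → p ≠ 3 → p ≠ 7 →
    ∀ (f g : MvPolynomial (Fin 3) k), f = MvPolynomial.X 2 ^ 2 + MvPolynomial.X 0 ^ 3 + MvPolynomial.X 1 ^ 7 →
    g = MvPolynomial.X 2 ^ 2 + 1 + MvPolynomial.X 1 ^ 7 →
    MvPolynomial.aeval (fun j : Fin 3 => if j = 0 then (MvPolynomial.X 0 : MvPolynomial (Fin 3) k) ^ 14
      else MvPolynomial.X j * MvPolynomial.X 0 ^ ((![14, 6, 21] : Fin 3 → ℕ) j)) f = MvPolynomial.X 0 ^ 42 * g ∧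
    MvPolynomial.IsWeightedHomogeneous (![1, -6, -21] : Fin 3 → ZMod 14) g 0 ∧
    ¬ (MvPolynomial.X 0 : MvPolynomial (Fin 3) k) ∣ g ∧
    ∀ (Q : Ideal (MvPolynomial (Fin 3) k ⧸ Ideal.span {g})) [Q.IsMaximal], ∀ d : ℕ,
      ringKrullDim (Localization.AtPrime Q) = d → ∀ s : Fin d → Localization.AtPrime Q,
      (Ideal.span (Set.range s)).radical.IsMaximal →
        RingTheory.Sequence.IsWeaklyRegular (Localization.AtPrime Q) (List.ofFn s) ∧
        ∀ y : Localization.AtPrime Q, (∃ e : ℕ, y ^ p ^ e ∈ Ideal.span ((fun z : Localization.AtPrime Q =>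
          z ^ p ^ e) '' (Ideal.span (Set.range s) : Set (Localization.AtPrime Q)))) → y ∈ Ideal.span (Set.range s) := by
  intro p _ k _ _ hp2 _hp3 hp7 f g hf hg
  refine ⟨?_, hg ▸ isWeightedHomogeneous_g0 k, ?_, ?_⟩
  · subst hf hg
    simp only [map_add, map_pow, MvPolynomial.aeval_X, Fin.isValue, Fin.reduceEq,
      ↓reduceIte, Matrix.cons_val_one, Matrix.cons_val]
    ring
  · refine not_X_dvd_of_eval_zero k 0 g ?_
    rw [hg]
    simp only [map_add, map_pow, map_one, MvPolynomial.eval_X, Fin.isValue]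
    norm_num
  · have hu2 : IsUnit (2 : MvPolynomial (Fin 3) k) := by
      simpa using isUnit_natCast_of_ne p k 2 Nat.prime_two hp2
    have hu7 : IsUnit (7 : MvPolynomial (Fin 3) k) := by
      simpa using isUnit_natCast_of_ne p k 7 (by norm_num) hp7
    refine clause_of_two_partials p k g 2 1 2 1 1 6 2 7 (X 2) (X 1 ^ 6) hu2 hu7 ?_ ?_ ?_
    · rw [hg, pderiv_two_g0, pow_one]
    · rw [hg, pderiv_one_g0]
    · rw [hg]; ring

/-- **The `y`-chart (`v = 1`)**: `θ₁ f = X₁^42 · g₁`, `g₁ = X₂² + X₀³ + 1` weighted homogeneous of weight `0`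
for `(-14,1,-21)` in `ZMod 6`, `X₁ ∤ g₁`, and — for `p ∉ {2,3,7}` — the clause at every maximal ideal of
`k[X]/(g₁)` (smooth: `∂₂ g₁ = 2X₂`, `∂₀ g₁ = 3X₀²`, `g₁ ≡ 1 mod (X₂, X₀)`). [folklore] -/
theorem bp237ChartY : ∀ (p : ℕ) [Fact p.Prime] (k : Type) [Field k] [CharP k p], p ≠ 2 → p ≠ 3 → p ≠ 7 →
    ∀ (f g : MvPolynomial (Fin 3) k), f = MvPolynomial.X 2 ^ 2 + MvPolynomial.X 0 ^ 3 + MvPolynomial.X 1 ^ 7 →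
    g = MvPolynomial.X 2 ^ 2 + MvPolynomial.X 0 ^ 3 + 1 →
    MvPolynomial.aeval (fun j : Fin 3 => if j = 1 then (MvPolynomial.X 1 : MvPolynomial (Fin 3) k) ^ 6
      else MvPolynomial.X j * MvPolynomial.X 1 ^ ((![14, 6, 21] : Fin 3 → ℕ) j)) f = MvPolynomial.X 1 ^ 42 * g ∧
    MvPolynomial.IsWeightedHomogeneous (![-14, 1, -21] : Fin 3 → ZMod 6) g 0 ∧
    ¬ (MvPolynomial.X 1 : MvPolynomial (Fin 3) k) ∣ g ∧
    ∀ (Q : Ideal (MvPolynomial (Fin 3) k ⧸ Ideal.span {g})) [Q.IsMaximal], ∀ d : ℕ,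
      ringKrullDim (Localization.AtPrime Q) = d → ∀ s : Fin d → Localization.AtPrime Q,
      (Ideal.span (Set.range s)).radical.IsMaximal →
        RingTheory.Sequence.IsWeaklyRegular (Localization.AtPrime Q) (List.ofFn s) ∧
        ∀ y : Localization.AtPrime Q, (∃ e : ℕ, y ^ p ^ e ∈ Ideal.span ((fun z : Localization.AtPrime Q =>
          z ^ p ^ e) '' (Ideal.span (Set.range s) : Set (Localization.AtPrime Q)))) → y ∈ Ideal.span (Set.range s) := by
  intro p _ k _ _ hp2 hp3 _hp7 f g hf hg
  refine ⟨?_, hg ▸ isWeightedHomogeneous_g1 k, ?_, ?_⟩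
  · subst hf hg
    simp only [map_add, map_pow, MvPolynomial.aeval_X, Fin.isValue, Fin.reduceEq,
      ↓reduceIte, Matrix.cons_val_zero, Matrix.cons_val]
    ring
  · refine not_X_dvd_of_eval_zero k 1 g ?_
    rw [hg]
    simp only [map_add, map_pow, map_one, MvPolynomial.eval_X, Fin.isValue]
    norm_num
  · have hu2 : IsUnit (2 : MvPolynomial (Fin 3) k) := by
      simpa using isUnit_natCast_of_ne p k 2 Nat.prime_two hp2
    have hu3 : IsUnit (3 : MvPolynomial (Fin 3) k) := by
      simpa using isUnit_natCast_of_ne p k 3 Nat.prime_three hp3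
    refine clause_of_two_partials p k g 2 0 2 0 1 2 2 3 (X 2) (X 0 ^ 2) hu2 hu3 ?_ ?_ ?_
    · rw [hg, pderiv_two_g1, pow_one]
    · rw [hg, pderiv_zero_g1]
    · rw [hg]; ring

/-- **The `z`-chart (`v = 2`)**: `θ₂ f = X₂^42 · g₂`, `g₂ = 1 + X₀³ + X₁⁷` weighted homogeneous of weight `0`
for `(-14,-6,1)` in `ZMod 21`, `X₂ ∤ g₂`, and — for `p ∉ {2,3,7}` — the clause at every maximal ideal of
`k[X]/(g₂)` (smooth: `∂₀ g₂ = 3X₀²`, `∂₁ g₂ = 7X₁⁶`, `g₂ ≡ 1 mod (X₀, X₁)`). [folklore] -/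
theorem bp237ChartZ : ∀ (p : ℕ) [Fact p.Prime] (k : Type) [Field k] [CharP k p], p ≠ 2 → p ≠ 3 → p ≠ 7 →
    ∀ (f g : MvPolynomial (Fin 3) k), f = MvPolynomial.X 2 ^ 2 + MvPolynomial.X 0 ^ 3 + MvPolynomial.X 1 ^ 7 →
    g = 1 + MvPolynomial.X 0 ^ 3 + MvPolynomial.X 1 ^ 7 →
    MvPolynomial.aeval (fun j : Fin 3 => if j = 2 then (MvPolynomial.X 2 : MvPolynomial (Fin 3) k) ^ 21
      else MvPolynomial.X j * MvPolynomial.X 2 ^ ((![14, 6, 21] : Fin 3 → ℕ) j)) f = MvPolynomial.X 2 ^ 42 * g ∧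
    MvPolynomial.IsWeightedHomogeneous (![-14, -6, 1] : Fin 3 → ZMod 21) g 0 ∧
    ¬ (MvPolynomial.X 2 : MvPolynomial (Fin 3) k) ∣ g ∧
    ∀ (Q : Ideal (MvPolynomial (Fin 3) k ⧸ Ideal.span {g})) [Q.IsMaximal], ∀ d : ℕ,
      ringKrullDim (Localization.AtPrime Q) = d → ∀ s : Fin d → Localization.AtPrime Q,
      (Ideal.span (Set.range s)).radical.IsMaximal →
        RingTheory.Sequence.IsWeaklyRegular (Localization.AtPrime Q) (List.ofFn s) ∧
        ∀ y : Localization.AtPrime Q, (∃ e : ℕ, y ^ p ^ e ∈ Ideal.span ((fun z : Localization.AtPrime Q =>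
          z ^ p ^ e) '' (Ideal.span (Set.range s) : Set (Localization.AtPrime Q)))) → y ∈ Ideal.span (Set.range s) := by
  intro p _ k _ _ _hp2 hp3 hp7 f g hf hg
  refine ⟨?_, hg ▸ isWeightedHomogeneous_g2 k, ?_, ?_⟩
  · subst hf hg
    simp only [map_add, map_pow, MvPolynomial.aeval_X, Fin.isValue, Fin.reduceEq,
      ↓reduceIte, Matrix.cons_val_zero, Matrix.cons_val_one]
    ring
  · refine not_X_dvd_of_eval_zero k 2 g ?_
    rw [hg]
    simp only [map_add, map_pow, map_one, MvPolynomial.eval_X, Fin.isValue]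
    norm_num
  · have hu3 : IsUnit (3 : MvPolynomial (Fin 3) k) := by
      simpa using isUnit_natCast_of_ne p k 3 Nat.prime_three hp3
    have hu7 : IsUnit (7 : MvPolynomial (Fin 3) k) := by
      simpa using isUnit_natCast_of_ne p k 7 (by norm_num) hp7
    refine clause_of_two_partials p k g 0 1 0 1 2 6 3 7 (X 0 ^ 2) (X 1 ^ 6) hu3 hu7 ?_ ?_ ?_
    · rw [hg, pderiv_zero_g2]
    · rw [hg, pderiv_one_g2]
    · rw [hg]; ring

end Summit.ResolutionOfSingularities.ResolutionOfSingularities.Theorems.FInjectiveMacaulayfication.BP237Charts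

end
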